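import Literature.AlgebraicGeometry.Motives.ClosedSubschemeCohomologySequence
import Literature.AlgebraicGeometry.Deformation.InvertibleSheafExtensionsFlatSmallExtension
import Literature.AlgebraicGeometry.Deformation.FlatDeformationGlobalFunctions
import Literature.AlgebraicGeometry.Deformation.ThickeningCohomologyTransport
import Literature.AlgebraicGeometry.Modules.AffineVanishing
import HarnessLib

/-!
# Affine modulo a nilpotent thickening: a scheme flat over an Artinian local ring with affine closed fibre is affine
# (EGA I 5.1.9 ∕ Stacks 06AD «`X ⊂ X'` a thickening: `X` affine ⟺ `X'` affine», the flat Artinian case)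

Layer `Literature/AlgebraicGeometry/Morphisms` (cell `hodgecm-mathlib`, F-11 α1 grandchild `F11LiftWithLineBundle`, the
Chevalley brick of the F3c dictionary «an actual flat lift is glued from affine charts» — road (β) of RULINGS #3 (R13);
theorems only — no definition, no instance, no notation, no named fact).

* §1 **`isAffine_of_appTop_surjective_of_isNilpotent`** — the TOPOLOGICAL HEART (no cohomology): if `i : X ⟶ X'` is a
  surjective closed immersion (a homeomorphism onto `X'`) with `i♯ : Γ(X', 𝒪) → Γ(X, 𝒪)` ONTO and with nil kernel, and `X`
  is affine, then `X'` is affine.  Proof: `i ≫ X'.toSpecΓ = X.toSpecΓ ≫ Spec(i♯)` (Mathlib `Scheme.toSpecΓ_naturality`);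
  `X.toSpecΓ` is an isomorphism, `Spec(i♯)` is a homeomorphism (a surjection with nil kernel), `i` is a homeomorphism
  — so `X'.toSpecΓ` is a homeomorphism, hence an AFFINE morphism (Mathlib `isAffineHom_of_isInducing`, Stacks 04DE), and
  `X'` is affine (`isAffine_of_isAffineHom`).
* §2 **`isAffine_of_isFirstOrderThickening_of_subsingleton`** — for a first-order thickening `i` (square-zero ideal `𝓘`):
  `X` affine and `H¹(X', 𝓘) = 0` ⇒ `X'` affine (`i♯` is onto by the long exact sequence of `0 → 𝓘 → 𝒪_{X'} → i_*𝒪_X → 0`,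
  ★ `Motives/ClosedSubschemeCohomologySequence.restrictCohomology_surjective_of_subsingleton`; the two tree models of `𝓘`,
  `Modules.idealSheafOf` and `Deformation.idealModule`, agree: `Modules.algebraUnit = Deformation.structureModuleMap` by `rfl`
  and ★ `idealSheafOfIsoKernel`).
* §3 **`isAffine_of_flat_principalSmallExtension`** — for `X' → Spec C'` FLAT and a principal small extension `C' ↠ C`
  (`ker = (t₀)`, `t₀𝔪 = 0`, `t₀ ≠ 0`) with `X = X' ×_{C'} C` and closed fibre `X₀ = X' ×_{C'} K`: `X` and `X₀` affine ⇒ `X'`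
  affine (`H¹(X', 𝓘) ≅ H¹(X₀, 𝒪_{X₀}) = 0`, ★ `flatSmallExtensionIdealCohomologyEquiv` + ★ `Modules/AffineVanishing`).
* §4 **`isAffine_of_flat_of_isArtinianRing`** — `f : X ⟶ Spec C` flat, `C` Artinian local: if the closed fibre
  `X ×_C (C⧸𝔪)` is affine then `X` is affine (Noetherian induction on the ideals of `C`, peeling principal small extensions
  `C⧸J → C⧸(J + (t))`, `t ∈ (J : 𝔪)`, exactly as ★ `Deformation/FlatDeformationGlobalFunctions`); and the form for an OPEN
  `U ⊆ X` whose closed fibre is affine (`isAffineOpen_of_flat_of_isArtinianRing`).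

HONEST SCOPE: the general statement (any thickening, no flatness, Stacks 06AD) is NOT typed — it needs the dévissage of
`𝓘^k∕𝓘^{k+1}` as quasi-coherent `𝒪_X`-modules; the flat Artinian case is what the deformation-theoretic consumers use.
HC_CM is proved only modulo the 7 printed citations until rung 0 closes — nothing here bears on a summit statement.

## References
* [EGAI] A. Grothendieck, J. Dieudonné, *EGA I* (Publ. Math. IHÉS 4, 1960), Prop. (5.1.9), p. 130 (`𝒥` quasi-coherent
  nilpotent, `X₀ = (X, 𝒪_X∕𝒥)`: `X` affine ⟺ `X₀` affine), Cor. (5.1.10) (`X` affine ⟺ `X_red` affine).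
* [StacksProject] Tag 06AD (thickenings and affineness), Tag 04DE (inducing + closed range ⇒ affine), Tag 01XB (Serre vanishing).
* [Hartshorne2010] R. Hartshorne, *Deformation Theory*, GTM 257 (2010), §6 (6.1) and Thm. 6.4 (d) proof, pp. 46–51 (the
  induction on the length of `C`).
-/

noncomputable section

-- `TopCat.Presheaf`/`Scheme.Modules` are not reducible (as in Mathlib's `AlgebraicGeometry/Modules`).
set_option backward.isDefEq.respectTransparency false

open CategoryTheory Limits Opposite TopologicalSpace AlgebraicGeometry

universe u

namespace Literature.AlgebraicGeometry.Morphisms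

open Literature.AlgebraicGeometry.Deformation Literature.AlgebraicGeometry.Modules Literature.AlgebraicGeometry.Motives
  Literature.AlgebraicGeometry.HodgeTheory

/-! ## §1 The topological heart -/

section Topological

variable {X X' : Scheme.{u}} (i : X ⟶ X') [IsClosedImmersion i] [Surjective i]

/-- `Spec` of a surjective ring map with nil kernel is a homeomorphism (a surjective closed immersion).
[cite: StacksProject, Tag 06AD] -/
theorem isHomeomorph_specMap_of_surjective_of_isNilpotent {R S : CommRingCat.{u}} (φ : R ⟶ S)
    (hs : Function.Surjective φ) (hn : ∀ a, φ a = 0 → IsNilpotent a) : IsHomeomorph (Spec.map φ).base := by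
  haveI : IsClosedImmersion (Spec.map φ) := IsClosedImmersion.spec_of_surjective φ hs
  refine isHomeomorph_iff_isEmbedding_surjective.mpr ⟨(Spec.map φ).isClosedEmbedding.isEmbedding, fun q => ?_⟩
  -- every prime `q` of `R` contains the nil ideal `ker φ`, hence is the preimage of its image
  have hker : RingHom.ker φ.hom ≤ q.asIdeal := fun a ha =>
    nilradical_le_prime q.asIdeal (mem_nilradical.mpr (hn a ha))
  haveI : (Ideal.map φ.hom q.asIdeal).IsPrime := Ideal.map_isPrime_of_surjective hs hker
  refine ⟨⟨Ideal.map φ.hom q.asIdeal, inferInstance⟩, PrimeSpectrum.ext ?_⟩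
  change Ideal.comap φ.hom (Ideal.map φ.hom q.asIdeal) = q.asIdeal
  rw [Ideal.comap_map_of_surjective _ hs, sup_eq_left]
  exact le_trans (fun a ha => ha) hker

/-- **Affineness is insensitive to a nilpotent thickening with liftable functions** (the topological heart of
[EGAI] (5.1.9) ∕ Stacks 06AD): `i : X ⟶ X'` a surjective closed immersion with `i♯ : Γ(X', 𝒪) → Γ(X, 𝒪)` onto and with nil
kernel, `X` affine ⇒ `X'` affine. [cite: StacksProject, Tag 06AD] [cite: StacksProject, Tag 04DE] -/
theorem isAffine_of_appTop_surjective_of_isNilpotent [IsAffine X] (hs : Function.Surjective i.appTop)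
    (hn : ∀ a, i.appTop a = 0 → IsNilpotent a) : IsAffine X' := by
  -- `i ≫ X'.toSpecΓ = X.toSpecΓ ≫ Spec(i♯)` is a homeomorphism
  have hφ := isHomeomorph_specMap_of_surjective_of_isNilpotent i.appTop hs hn
  have hX : IsHomeomorph X.toSpecΓ.base := (Scheme.homeoOfIso X.isoSpec).isHomeomorph
  have hcomp : IsHomeomorph (i ≫ X'.toSpecΓ).base := by
    rw [Scheme.toSpecΓ_naturality, Scheme.Hom.comp_base, TopCat.coe_comp]
    exact hφ.comp hX
  -- hence so is `X'.toSpecΓ` (`i` is a homeomorphism)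
  have hi : IsHomeomorph i.base := (baseHomeomorph i).isHomeomorph
  have ht : IsHomeomorph X'.toSpecΓ.base := by
    have heq : ⇑X'.toSpecΓ.base = ⇑(i ≫ X'.toSpecΓ).base ∘ (hi.homeomorph i.base).symm := by
      funext x
      change X'.toSpecΓ.base x = (i ≫ X'.toSpecΓ).base ((hi.homeomorph i.base).symm x)
      rw [Scheme.Hom.comp_base, TopCat.coe_comp, Function.comp_apply]
      congr 1
      exact ((hi.homeomorph i.base).apply_symm_apply x).symm
    rw [heq]
    exact hcomp.comp (hi.homeomorph i.base).symm.isHomeomorph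
  -- a homeomorphism is an affine morphism (Stacks 04DE); the target is affine
  haveI : IsAffineHom X'.toSpecΓ :=
    isAffineHom_of_isInducing _ (isHomeomorph_iff_isEmbedding_surjective.mp ht).1.isInducing
      (by rw [ht.surjective.range_eq]; exact isClosed_univ)
  exact isAffine_of_isAffineHom X'.toSpecΓ

end Topological

/-! ## §2 First-order thickenings with `H¹(𝓘) = 0` -/

section FirstOrder

variable {X X' : Scheme.{u}} (i : X ⟶ X') [IsClosedImmersion i] [Surjective i]

omit [Surjective i] in
/-- The two tree models of the ideal sheaf of a closed immersion agree: `Modules.idealSheafOf i ≅ Deformation.idealModule i`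
(`𝓘·𝒪_{X'}` vs `ker(i♯)` — ★ `idealSheafOfIsoKernel`, and `Modules.algebraUnit i = structureModuleMap i` definitionally), read on
cohomology: `H¹(X', 𝓘) = 0` transfers. [cite: StacksProject, Tag 01QN] -/
theorem subsingleton_H_idealSheafOf_of_subsingleton (n : ℕ) [Subsingleton ((idealSheafAb i).H n)] :
    Subsingleton (Sheaf.H ((SheafOfModules.toSheaf X'.ringCatSheaf).obj (idealSheafOf i)) n) := by
  let e : (SheafOfModules.toSheaf X'.ringCatSheaf).obj (idealSheafOf i) ≅ idealSheafAb i :=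
    (SheafOfModules.toSheaf X'.ringCatSheaf).mapIso (idealSheafOfIsoKernel i)
  refine ⟨fun x y => ?_⟩
  have hx : Sheaf.H.map e.inv n (Sheaf.H.map e.hom n x) = x := by
    rw [← Sheaf.H.map_comp_apply, Iso.hom_inv_id, Sheaf.H.map_id_apply]
  have hy : Sheaf.H.map e.inv n (Sheaf.H.map e.hom n y) = y := by
    rw [← Sheaf.H.map_comp_apply, Iso.hom_inv_id, Sheaf.H.map_id_apply]
  rw [← hx, ← hy, Subsingleton.elim (Sheaf.H.map e.hom n x) (Sheaf.H.map e.hom n y)]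

omit [Surjective i] in
/-- **`H¹(X', 𝓘) = 0` ⇒ `i♯ : Γ(X', 𝒪) → Γ(X, 𝒪)` is onto** (long exact sequence of `0 → 𝓘 → 𝒪_{X'} → i_*𝒪_X → 0` in
degree `0`, ★ `Motives/ClosedSubschemeCohomologySequence`). [cite: StacksProject, Tag 01QN] [cite: StacksProject, Tag 06AD] -/
theorem appTop_surjective_of_subsingleton_H1 [Subsingleton ((idealSheafAb i).H 1)] : Function.Surjective i.appTop := by
  haveI := subsingleton_H_idealSheafOf_of_subsingleton i 1
  intro a
  obtain ⟨x, hx⟩ := restrictCohomology_surjective_of_subsingleton i 0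
    ((Sheaf.H.equiv₀ (structureSheafAb X) isTerminalTop).symm a)
  refine ⟨Sheaf.H.equiv₀ (structureSheafAb X') isTerminalTop x, ?_⟩
  rw [← equiv₀_restrictCohomology i x, hx, AddEquiv.apply_symm_apply]

end FirstOrder

/-- **A first-order thickening of an affine scheme with `H¹(X', 𝓘) = 0` is affine**: `i♯` is onto (§ above) and its kernel
`Γ(X', 𝓘)` has square zero. [cite: StacksProject, Tag 06AD] -/
theorem isAffine_of_isFirstOrderThickening_of_subsingleton {X X' : Scheme.{u}} (i : X ⟶ X') [IsFirstOrderThickening i]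
    [IsAffine X] [Subsingleton ((idealSheafAb i).H 1)] : IsAffine X' :=
  isAffine_of_appTop_surjective_of_isNilpotent i (appTop_surjective_of_subsingleton_H1 i) fun a ha =>
    ⟨2, by rw [pow_two]; exact mul_eq_zero_of_app_eq_zero i ha ha⟩

/-! ## §3 Flat principal small extensions -/

section PrincipalSmall

open IsLocalRing

variable {X X' X₀ : Scheme.{u}} {C' C K : Type u} [CommRing C'] [IsLocalRing C'] [CommRing C] [CommRing K]
  (f : X' ⟶ Spec (.of C')) [Flat f]
  (p : C' →+* C) (hp : Function.Surjective p) (t₀ : C') (hker : RingHom.ker p = Ideal.span {t₀})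
  {i : X ⟶ X'} {g : X ⟶ Spec (.of C)}
  (π₀ : C' →+* K) (hπ₀ : Function.Surjective π₀) (hkπ : RingHom.ker π₀ = maximalIdeal C')
  (htm : ∀ m ∈ maximalIdeal C', t₀ * m = 0) (ht₀ : t₀ ≠ 0) (ht₀m : t₀ ∈ maximalIdeal C')
  {j : X₀ ⟶ X'} {g₀ : X₀ ⟶ Spec (.of K)} [IsClosedImmersion j] [Surjective j]
  (Hi : IsPullback i g f (Spec.map (CommRingCat.ofHom p))) (Hj : IsPullback j g₀ f (Spec.map (CommRingCat.ofHom π₀)))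

include hp hker hπ₀ hkπ htm ht₀ ht₀m Hi Hj in
/-- **Along a FLAT principal small extension, affineness lifts**: `X' → Spec C'` flat, `C' ↠ C` with kernel `(t₀)`,
`t₀𝔪 = 0`, `t₀ ≠ 0`, `X = X' ×_{C'} C`, closed fibre `X₀ = X' ×_{C'} K`; if `X` and `X₀` are affine then `X'` is affine —
`X ↪ X'` is a first-order thickening with `H¹(X', 𝓘) ≅ H¹(X₀, 𝒪_{X₀}) = 0` (★ `flatSmallExtensionIdealCohomologyEquiv`,
Serre vanishing on the affine `X₀`). [cite: StacksProject, Tag 06AD] [cite: StacksProject, Tag 01XB]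
[cite: Hartshorne2010, §6 (6.1), pp. 46–47] -/
theorem isAffine_of_flat_principalSmallExtension [IsAffine X] [IsAffine X₀] : IsAffine X' := by
  haveI : IsFirstOrderThickening i :=
    isFirstOrderThickening_of_isPullback_of_ker_eq_span f p hp t₀ hker (htm t₀ ht₀m) Hi
  -- `H¹(X', 𝓘) ≅ H¹(X₀, 𝒪) = 0`
  haveI : Subsingleton (structureSheafCohomology X₀ 1) :=
    AffineVanishing.subsingleton_H_of_isAffine (unitModule X₀) IsAffineLocalizing.unit 0
  haveI : Subsingleton ((idealSheafAb i).H 1) :=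
    (flatSmallExtensionIdealCohomologyEquiv f p hp t₀ hker π₀ hπ₀ hkπ htm ht₀ Hi Hj 1).symm.subsingleton
  exact isAffine_of_isFirstOrderThickening_of_subsingleton i

end PrincipalSmall

/-! ## §4 Flat over an Artinian local ring: induction on the length -/

section Artinian

open IsLocalRing

variable {X : Scheme.{u}} {C : Type u} [CommRing C] (f : X ⟶ Spec (.of C))

/-- `Spec` of a quotient map `C⧸J → C⧸J'` (`J ≤ J'`) of an Artinian local ring is surjective on points (a nilpotent
thickening). [cite: StacksProject, Tag 06AD] -/
theorem surjective_specMap_quotientTransition [IsArtinianRing C] [IsLocalRing C] {J J' : Ideal C} (h : J ≤ J')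
    (hJ' : J' ≠ ⊤) : Surjective (Spec.map (CommRingCat.ofHom (quotientTransition h))) := by
  haveI : Nontrivial (C ⧸ J') := Ideal.Quotient.nontrivial_iff.mpr hJ'
  haveI : Nontrivial (C ⧸ J) :=
    Ideal.Quotient.nontrivial_iff.mpr fun hJ => hJ' (top_le_iff.mp (hJ ▸ h))
  haveI : IsLocalRing (C ⧸ J) := IsLocalRing.of_surjective' (Ideal.Quotient.mk J) Ideal.Quotient.mk_surjective
  haveI : IsArtinianRing (C ⧸ J) := inferInstance
  refine ⟨(isHomeomorph_specMap_of_surjective_of_isNilpotent (CommRingCat.ofHom (quotientTransition h))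
    (quotientTransition_surjective h) fun a ha => ?_).surjective⟩
  -- the kernel lies in the (nilpotent) maximal ideal of the Artinian local ring `C⧸J`
  have hmem : a ∈ maximalIdeal (C ⧸ J) := by
    rw [IsLocalRing.mem_maximalIdeal, mem_nonunits_iff]
    intro hu
    have h1 : IsUnit (quotientTransition h a) := hu.map _
    rw [show quotientTransition h a = 0 from ha] at h1
    exact not_isUnit_zero h1
  have hnil : IsNilpotent (maximalIdeal (C ⧸ J)) := by
    rw [← IsLocalRing.jacobson_eq_maximalIdeal ⊥ bot_ne_top]
    exact IsArtinianRing.isNilpotent_jacobson_bot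
  obtain ⟨n, hn⟩ := hnil
  exact ⟨n, by
    have hmem' := Ideal.pow_mem_pow hmem n
    rw [hn] at hmem'
    exact (Ideal.mem_bot).mp hmem'⟩

/-- **Induction on the length of `C`**: for `X → Spec C` flat, `C` Artinian local, if the closed fibre `X ×_C (C⧸𝔪)` is
affine then every `X ×_C (C⧸J)` (`J ≠ ⊤`) is affine — Noetherian induction on `J`, one principal small extension
`C⧸J → C⧸(J + (t))` at a time (§3), as in ★ `Deformation/FlatDeformationGlobalFunctions`.
[cite: StacksProject, Tag 06AD] [cite: Hartshorne2010, §6 proof of Thm. 6.4 (d), p. 51 (induction on the length of `C`)] -/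
theorem isAffine_quotientFibre_of_flat [IsArtinianRing C] [IsLocalRing C] [Flat f]
    (hX : IsAffine (quotientFibre f (maximalIdeal C))) {J : Ideal C} (hJ : J ≠ ⊤) : IsAffine (quotientFibre f J) := by
  revert hJ
  induction J using IsNoetherian.induction with
  | hgt J ih =>
    intro hJ
    by_cases hm : J = maximalIdeal C
    · subst hm
      exact hX
    have hlt : J < maximalIdeal C := lt_of_le_of_ne (IsLocalRing.le_maximalIdeal hJ) hm
    obtain ⟨t, htm, htJ, hann⟩ := exists_mem_socle_rel J hlt
    -- the next ideal `J'' = J + (t)` and the small extension `C/J → C/J''`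
    have hJJ'' : J < J ⊔ Ideal.span {t} :=
      lt_of_le_of_ne le_sup_left fun h => htJ (h ▸ Ideal.mem_sup_right (Ideal.mem_span_singleton_self t))
    have hJ''m : J ⊔ Ideal.span {t} ≤ maximalIdeal C :=
      sup_le hlt.le ((Ideal.span_singleton_le_iff_mem _).mpr htm)
    have hJ''top : J ⊔ Ideal.span {t} ≠ ⊤ := fun h =>
      (maximalIdeal.isMaximal C).ne_top (top_le_iff.mp (h ▸ hJ''m))
    haveI ih'' : IsAffine (quotientFibre f (J ⊔ Ideal.span {t})) := ih _ hJJ'' hJ''top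
    have hmJ : maximalIdeal C * (J ⊔ Ideal.span {t}) ≤ J := by
      rw [Ideal.mul_sup]
      refine sup_le Ideal.mul_le_left (Ideal.mul_le.mpr fun m hm s hs => ?_)
      obtain ⟨a, rfl⟩ := Ideal.mem_span_singleton'.mp hs
      rw [← mul_assoc, mul_comm m a, mul_assoc, mul_comm]
      exact Ideal.mul_mem_right _ _ (by rw [mul_comm]; exact hann m hm)
    obtain ⟨hpsurj, hpker, ht0, hpann⟩ := Ideal.Quotient.lift_isSmall_of_sup_span_singleton_eq (B := C) hmJ htJ rfl
      (Ideal.Quotient.mk (J ⊔ Ideal.span {t})) Ideal.Quotient.mk_surjective Ideal.mk_ker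
      (fun a ha => Ideal.Quotient.eq_zero_iff_mem.mpr ((le_sup_left : J ≤ J ⊔ Ideal.span {t}) ha))
    -- local instances on `C/J`
    haveI : Nontrivial (C ⧸ J) := Ideal.Quotient.nontrivial_iff.mpr hJ
    haveI : IsLocalRing (C ⧸ J) := IsLocalRing.of_surjective' (Ideal.Quotient.mk J) Ideal.Quotient.mk_surjective
    haveI : Nontrivial (C ⧸ maximalIdeal C) := Ideal.Quotient.nontrivial_iff.mpr (maximalIdeal.isMaximal C).ne_top
    haveI := flat_quotientFibreSnd f J
    haveI : IsClosedImmersion (quotientFibreMap f hlt.le) :=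
      isClosedImmersion_of_isPullback_fibre (quotientFibreSnd f J) (quotientTransition hlt.le)
        (quotientTransition_surjective hlt.le) (isPullback_quotientFibreMap f hlt.le)
    haveI : Surjective (quotientFibreMap f hlt.le) :=
      MorphismProperty.of_isPullback (P := @Surjective) (isPullback_quotientFibreMap f hlt.le).flip
        (surjective_specMap_quotientTransition hlt.le (maximalIdeal.isMaximal C).ne_top)
    haveI : IsAffine (quotientFibre f (maximalIdeal C)) := hX
    have htm' : ∀ m ∈ maximalIdeal (C ⧸ J), Ideal.Quotient.mk J t * m = 0 := fun m hm =>
      hpann _ (by rw [hpker]; exact Ideal.mem_span_singleton_self _) m ((IsLocalRing.mem_maximalIdeal m).mp hm)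
    have hkπ : RingHom.ker (quotientTransition hlt.le) = maximalIdeal (C ⧸ J) := by
      rw [quotientTransition, Ideal.ker_quotient_lift, Ideal.mk_ker]
      exact IsLocalRing.map_maximalIdeal_of_surjective _ Ideal.Quotient.mk_surjective
    have ht₀m : Ideal.Quotient.mk J t ∈ maximalIdeal (C ⧸ J) := by
      rw [← hkπ, RingHom.mem_ker]
      change Ideal.Quotient.lift J (Ideal.Quotient.mk (maximalIdeal C)) _ (Ideal.Quotient.mk J t) = 0
      rw [Ideal.Quotient.lift_mk]
      exact Ideal.Quotient.eq_zero_iff_mem.mpr htm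
    exact isAffine_of_flat_principalSmallExtension (quotientFibreSnd f J) (quotientTransition (le_sup_left))
      hpsurj (Ideal.Quotient.mk J t) hpker (quotientTransition hlt.le) (quotientTransition_surjective hlt.le) hkπ htm'
      ht0 ht₀m (isPullback_quotientFibreMap f le_sup_left) (isPullback_quotientFibreMap f hlt.le)

/-- **A scheme flat over an Artinian local ring whose closed fibre is affine is affine** (`X ×_C (C⧸𝔪)` Mathlib's chosen
fibre product). [cite: StacksProject, Tag 06AD] [cite: EGAI, Prop. (5.1.9)] -/
theorem isAffine_of_flat_of_isArtinianRing_quotientFibre [IsArtinianRing C] [IsLocalRing C] [Flat f]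
    (hX : IsAffine (quotientFibre f (maximalIdeal C))) : IsAffine X := by
  haveI := isAffine_quotientFibre_of_flat f hX (J := ⊥) bot_ne_top
  have hmk : Function.Bijective (Ideal.Quotient.mk (⊥ : Ideal C)) :=
    ⟨(RingHom.injective_iff_ker_eq_bot _).mpr Ideal.mk_ker, Ideal.Quotient.mk_surjective⟩
  haveI : IsIso (Spec.map (CommRingCat.ofHom (Ideal.Quotient.mk (⊥ : Ideal C)))) := by
    haveI : IsIso (CommRingCat.ofHom (Ideal.Quotient.mk (⊥ : Ideal C))) :=
      (ConcreteCategory.isIso_iff_bijective _).mpr hmk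
    infer_instance
  haveI : IsIso (quotientFibreFst f ⊥) := (isPullback_quotientFibre f ⊥).isIso_fst_of_isIso
  exact IsAffine.of_isIso (inv (quotientFibreFst f ⊥))

/-- **The same for ANY presentation of the closed fibre** as a cartesian square over `Spec (C⧸𝔪) → Spec C`.
[cite: StacksProject, Tag 06AD] [cite: EGAI, Prop. (5.1.9)] -/
theorem isAffine_of_flat_of_isArtinianRing [IsArtinianRing C] [IsLocalRing C] [Flat f] {X₀ : Scheme.{u}}
    {j : X₀ ⟶ X} {g₀ : X₀ ⟶ Spec (.of (C ⧸ maximalIdeal C))}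
    (Hj : IsPullback j g₀ f (Spec.map (CommRingCat.ofHom (Ideal.Quotient.mk (maximalIdeal C))))) [IsAffine X₀] :
    IsAffine X := by
  have e := Hj.isoIsPullback _ _ (isPullback_quotientFibre f (maximalIdeal C))
  haveI : IsAffine (quotientFibre f (maximalIdeal C)) := IsAffine.of_isIso e.inv
  exact isAffine_of_flat_of_isArtinianRing_quotientFibre f inferInstance

/-- **Opens with affine closed fibre are affine**: `X → Spec C` flat, `C` Artinian local, `j : X₀ ⟶ X` the closed fibre
(a cartesian square over `Spec (C⧸𝔪) → Spec C`); an open `U ⊆ X` with `j⁻¹U` affine is affine — the Chevalley brick of the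
deformation-theoretic dictionary «a flat lift of an affine-charted scheme is affine-charted by the same opens».
[cite: StacksProject, Tag 06AD] [cite: EGAI, Cor. (5.1.10)] -/
theorem isAffineOpen_of_flat_of_isArtinianRing [IsArtinianRing C] [IsLocalRing C] [Flat f] {X₀ : Scheme.{u}}
    {j : X₀ ⟶ X} {g₀ : X₀ ⟶ Spec (.of (C ⧸ maximalIdeal C))}
    (Hj : IsPullback j g₀ f (Spec.map (CommRingCat.ofHom (Ideal.Quotient.mk (maximalIdeal C)))))
    (U : X.Opens) (hU : IsAffineOpen (j ⁻¹ᵁ U)) : IsAffineOpen U := by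
  haveI : IsAffine (j ⁻¹ᵁ U : Scheme.{u}) := hU
  haveI : Flat (U.ι ≫ f) := inferInstance
  have Hsq : IsPullback (j ∣_ U) ((j ⁻¹ᵁ U).ι ≫ g₀) (U.ι ≫ f)
      (Spec.map (CommRingCat.ofHom (Ideal.Quotient.mk (maximalIdeal C)))) :=
    (isPullback_morphismRestrict j U).paste_vert Hj
  exact isAffine_of_flat_of_isArtinianRing (U.ι ≫ f) Hsq

end Artinian

end Literature.AlgebraicGeometry.Morphisms

end
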